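import Literature.NumberTheory.LFunctions.ThetaChainCheck
import HarnessLib

/-!
# Schoenfeld's `θ`-bound on `[599, 4599989]` by kernel computation: certified run, chunk 10 of 17
# (plan N2 of provefact `Literature.NumberTheory.LFunctions.robin_iff`)

Topic: `Literature/NumberTheory/LFunctions`. Pure proof file (a kernel computation; nothing is
asserted, no definition). `run10` evaluates `ThetaChain.runD 20000` — at most `20000` steps of the
`θ`-chain of `ThetaChainCheck.lean` along the prime table `ChainTable.table`, each certifying the
primality of the next entry, extending the enclosures of `log p` and `θ(p)`, and performing the two
comparisons behind `|θ(x) − x| ≤ √x log² x/(8π)` on the interval just closed — on the state reached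
after `180000` steps (the literal on the left: the prime `2454619` with its enclosures, recorded by
chunk 9) and records the resulting state (the prime `2750161`, entry `200000` of
`table.tail`). The meaning of these states is supplied by `ThetaChain.runD_sound`
(`ThetaChainSound.lean`: the invariant `Inv` is preserved); the 17 chunks are assembled in
`ThetaSmallRange.lean`. The expected states were obtained by evaluating the same function compiled.
`decide +kernel`, standard axioms only (about half a minute of kernel time; `maxHeartbeats 0` lifts
the deterministic time-out for this one declaration).

## References

* L. Schoenfeld, *Sharper bounds for the Chebyshev functions θ(x) and ψ(x). II*, Math. Comp. 30
  (1976), 337–360, Thm. 10 (6.3) and p. 339. [Schoenfeld1976]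
-/

namespace Literature.NumberTheory.LFunctions.ThetaChainRun

open ThetaChain

set_option maxHeartbeats 0 in
/-- **Chunk 10 of the certified `θ`-run** (steps `180000` to `200000`, primes `2454619` to
`2750161`). [cite: Schoenfeld1976, Thm. 10 (6.3)] -/
theorem run10 :
    runD 20000
      ⟨2454619, 17787508423670760640516908, 17787508423671236250999861,
        2965039236398123209485466279608, 2965039236398208818501752762045⟩ =
    some ⟨2750161, 17924948660994961854401284, 17924948660995437465356607,
        3322187249553301516784072799223, 3322187249553396638014744460020⟩ := by
  decide +kernel

end Literature.NumberTheory.LFunctions.ThetaChainRun
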